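import Summits.QuantumAdvantage.QuantumAdvantage.Theorems.CharDialJLinPeel
import Summits.QuantumAdvantage.AdviceFreeQNC0.AffBells23WalkHardGen
import Summits.QuantumAdvantage.AdviceFreeQNC0.WindowLocalHard
import Summits.QuantumAdvantage.AdviceFreeQNC0.PredHard
import HarnessLib

/-!
# The block dial, part A: separated p-blocks, the piece map and the walk bookkeeping (decomp-qadv lens-6 g17 «OrbitDial», tree part 30M)

For `N` pairwise separated blocks `[s k, s k + p)` inside `{0,…,n−1}` (hypothesis `(∀ k k', k < k' → s k + p ≤ s k') ∧ ∀ k, s k + p ≤ n`)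
the PIECE MAP `bset p s u v` puts the constant bit `v k` on block `k` and keeps `u` elsewhere.  This part proves the weight / prefix-weight
bookkeeping (`wt_bset`, `wtPrefix_bset`) and the WALK FORMULA `walkExp_bset`: `walkExp (bset u v) g = offW + offP g + p·walkExp v (qcut g) +
[straddle term]`, where `qcut g` counts the blocks entirely before the cut and at most one block straddles it (`card_strad_le_one`).
Supports item stmt-QuantumAdvantage-32604 (`CharDial.WalkHardFJLinOdd`); source: pub annex g17/OrbitDial37.lean §37q REV12 (sha256 7a2cb935…), namespace `…Theses.OrbitDial.BlockDial`, statements and proofs verbatim with the Prop abbreviations `InBlk`/`IsConst`/`BlkSep` INLINED (Prop-free twin).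
-/

set_option autoImplicit false

namespace Summit.QuantumAdvantage.AdviceFreeQNC0.JLinPeel.BlockDial

open Finset
open Summit.QuantumAdvantage.AdviceFreeQNC0
open Literature.Computability.MetaComplexity Literature.Computability.MetaComplexity.Smolensky

section BlockPiece
variable {n N : ℕ}



/-- the `k`-th block as a set of coordinates. -/
def blk (p : ℕ) (s : Fin N → ℕ) (k : Fin N) : Finset (Fin n) := univ.filter fun i => (s k ≤ i.val ∧ i.val < s k + p)

/-- the union of the blocks. -/
def blkU (p : ℕ) (s : Fin N → ℕ) : Finset (Fin n) := univ.biUnion (blk (n := n) p s)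


variable {p : ℕ} {s : Fin N → ℕ}

/-- a coordinate lies in at most one block. -/
theorem inBlk_unique (h : ((∀ k k', k < k' → s k + p ≤ s k') ∧ (∀ k, s k + p ≤ n))) {k k' : Fin N} {i : Fin n} (hk : (s k ≤ i.val ∧ i.val < s k + p)) (hk' : (s k' ≤ i.val ∧ i.val < s k' + p)) :
    k = k' := by
  obtain ⟨h1, h2⟩ := hk
  obtain ⟨h1', h2'⟩ := hk'
  by_contra hne
  rcases lt_or_gt_of_ne hne with hlt | hlt
  · have := h.1 k k' hlt; omega
  · have := h.1 k' k hlt; omega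

/-- the BLOCK PIECE through `u`: block `k` carries the constant bit `v k`, every other coordinate keeps `u`. -/
noncomputable def bset (p : ℕ) (s : Fin N → ℕ) (u : Fin n → Bool) (v : Fin N → Bool) : Fin n → Bool := fun i =>
  if h : ∃ k, (s k ≤ i.val ∧ i.val < s k + p) then v h.choose else u i

/-- inside block `k` the piece point reads `v k`. -/
theorem bset_of_inBlk (h : ((∀ k k', k < k' → s k + p ≤ s k') ∧ (∀ k, s k + p ≤ n))) (u : Fin n → Bool) (v : Fin N → Bool) {k : Fin N} {i : Fin n}
    (hk : (s k ≤ i.val ∧ i.val < s k + p)) : bset p s u v i = v k := by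
  unfold bset
  have hex : ∃ k, (s k ≤ i.val ∧ i.val < s k + p) := ⟨k, hk⟩
  rw [dif_pos hex, inBlk_unique h hex.choose_spec hk]

/-- off the blocks the piece point reads `u`. -/
theorem bset_of_not_inBlk (u : Fin n → Bool) (v : Fin N → Bool) {i : Fin n} (hi : ∀ k, ¬ (s k ≤ i.val ∧ i.val < s k + p)) :
    bset p s u v i = u i := by
  unfold bset
  rw [dif_neg (not_exists.mpr hi)]

/-- membership in a block. -/
theorem mem_blk {k : Fin N} {i : Fin n} : i ∈ blk p s k ↔ (s k ≤ i.val ∧ i.val < s k + p) := by simp [blk]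

/-- membership in the union of the blocks. -/
theorem mem_blkU {i : Fin n} : i ∈ blkU p s ↔ ∃ k, (s k ≤ i.val ∧ i.val < s k + p) := by simp [blkU, mem_blk]

/-- off the union no block contains the coordinate. -/
theorem not_inBlk_of_mem_sdiff {i : Fin n} (hi : i ∈ univ \ blkU p s) : ∀ k, ¬ (s k ≤ i.val ∧ i.val < s k + p) := by
  rw [mem_sdiff, mem_blkU, not_exists] at hi
  exact hi.2

/-- every block has exactly `p` coordinates. -/
theorem card_blk (h : ((∀ k k', k < k' → s k + p ≤ s k') ∧ (∀ k, s k + p ≤ n))) (k : Fin N) : (blk (n := n) p s k).card = p := by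
  refine Finset.card_eq_of_bijective (fun j hj => ⟨s k + j, by have := h.2 k; omega⟩) ?_ ?_ ?_
  · intro i hi
    rw [mem_blk] at hi
    obtain ⟨h1, h2⟩ := hi
    exact ⟨i.val - s k, by omega, by ext; simp; omega⟩
  · intro j hj
    rw [mem_blk]
    exact ⟨by simp, by simp; omega⟩
  · intro j j' hj hj' hjj
    simpa using hjj

/-- the blocks are pairwise disjoint. -/
theorem blk_disjoint (h : ((∀ k k', k < k' → s k + p ≤ s k') ∧ (∀ k, s k + p ≤ n))) : Set.PairwiseDisjoint (↑(univ : Finset (Fin N))) (blk (n := n) p s) := by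
  intro k _ k' _ hne
  exact Finset.disjoint_left.mpr fun i hi hi' => hne (inBlk_unique h (mem_blk.mp hi) (mem_blk.mp hi'))

/-- a sum over all coordinates = the off-block part + the block parts. -/
theorem sum_split (h : ((∀ k k', k < k' → s k + p ≤ s k') ∧ (∀ k, s k + p ≤ n))) {M : Type*} [AddCommMonoid M] (f : Fin n → M) :
    ∑ i, f i = (∑ i ∈ univ \ blkU p s, f i) + ∑ k : Fin N, ∑ i ∈ blk p s k, f i := by
  rw [← Finset.sum_biUnion (blk_disjoint h)]
  exact (Finset.sum_sdiff (subset_univ _)).symm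

/-- off-block weight of `u`. -/
def offW (p : ℕ) (s : Fin N → ℕ) (u : Fin n → Bool) : ℕ := ((univ \ blkU p s).filter fun i => u i = true).card

/-- off-block prefix weight of `u` at cut `g`. -/
def offP (p : ℕ) (s : Fin N → ℕ) (u : Fin n → Bool) (g : ℕ) : ℕ :=
  ((univ \ blkU p s).filter fun i => i.val < g ∧ u i = true).card

/-- how much of block `k` lies before cut `g`. -/
def mcut (p : ℕ) (s : Fin N → ℕ) (k : Fin N) (g : ℕ) : ℕ := ((blk (n := n) p s k).filter fun i => i.val < g).card

/-- **weight on a block piece**: `wt (bset u v) = offW u + p·wt v`. -/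
theorem wt_bset (h : ((∀ k k', k < k' → s k + p ≤ s k') ∧ (∀ k, s k + p ≤ n))) (u : Fin n → Bool) (v : Fin N → Bool) :
    wt (bset p s u v) = offW p s u + p * wt v := by
  unfold wt offW
  rw [Finset.card_filter, sum_split h, Finset.card_filter, Finset.card_filter, Finset.mul_sum]
  congr 1
  · refine Finset.sum_congr rfl fun i hi => ?_
    rw [bset_of_not_inBlk u v (not_inBlk_of_mem_sdiff hi)]
  · refine Finset.sum_congr rfl fun k _ => ?_
    rw [Finset.sum_congr rfl fun i hi => by rw [bset_of_inBlk h u v (mem_blk.mp hi)], Finset.sum_const, card_blk h k,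
      smul_eq_mul]

/-- **prefix weight on a block piece**: `wtPrefix (bset u v) g = offP u g + Σ_k [v k]·mcut k g`. -/
theorem wtPrefix_bset (h : ((∀ k k', k < k' → s k + p ≤ s k') ∧ (∀ k, s k + p ≤ n))) (u : Fin n → Bool) (v : Fin N → Bool) (g : ℕ) :
    wtPrefix (bset p s u v) g = offP p s u g + ∑ k : Fin N, (if v k = true then mcut (n := n) p s k g else 0) := by
  unfold wtPrefix offP
  rw [Finset.card_filter, sum_split h, Finset.card_filter]
  congr 1
  · refine Finset.sum_congr rfl fun i hi => ?_
    rw [bset_of_not_inBlk u v (not_inBlk_of_mem_sdiff hi)]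
  · refine Finset.sum_congr rfl fun k _ => ?_
    rw [Finset.sum_congr rfl fun i hi => by rw [bset_of_inBlk h u v (mem_blk.mp hi)]]
    unfold mcut
    rw [Finset.card_filter]
    cases v k <;> simp

/-- a block entirely before the cut counts fully. -/
theorem mcut_of_before (h : ((∀ k k', k < k' → s k + p ≤ s k') ∧ (∀ k, s k + p ≤ n))) {k : Fin N} {g : ℕ} (hk : s k + p ≤ g) : mcut (n := n) p s k g = p := by
  unfold mcut
  rw [Finset.filter_true_of_mem fun i hi => ?_, card_blk h k]
  have := (mem_blk.mp hi).2
  omega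

/-- a block entirely after the cut counts nothing. -/
theorem mcut_of_after {k : Fin N} {g : ℕ} (hk : g ≤ s k) : mcut (n := n) p s k g = 0 := by
  unfold mcut
  rw [Finset.card_eq_zero, Finset.filter_eq_empty_iff]
  intro i hi
  have := (mem_blk.mp hi).1
  omega

/-- number of blocks entirely before cut `g` — the cut's position in block coordinates. -/
def qcut (p : ℕ) (s : Fin N → ℕ) (g : ℕ) : ℕ := (univ.filter fun k : Fin N => s k + p ≤ g).card

/-- **the blocks before a cut form an initial segment**: `s k + p ≤ g ↔ k < qcut g`. -/
theorem before_iff (h : ((∀ k k', k < k' → s k + p ≤ s k') ∧ (∀ k, s k + p ≤ n))) (g : ℕ) (k : Fin N) : s k + p ≤ g ↔ k.val < qcut p s g := by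
  constructor
  · intro hk
    have hsub : Finset.Iic k ⊆ univ.filter (fun k' : Fin N => s k' + p ≤ g) := by
      intro k' hk'
      rw [Finset.mem_Iic] at hk'
      rw [mem_filter]
      refine ⟨mem_univ _, ?_⟩
      rcases lt_or_eq_of_le hk' with hlt | heq
      · have := h.1 k' k hlt; omega
      · rw [heq]; exact hk
    have hc := card_le_card hsub
    rw [Fin.card_Iic] at hc
    unfold qcut
    omega
  · intro hk
    by_contra hge
    have hsub : univ.filter (fun k' : Fin N => s k' + p ≤ g) ⊆ Finset.Iio k := by
      intro k' hk'
      rw [mem_filter] at hk'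
      rw [Finset.mem_Iio]
      by_contra hle
      rw [not_lt] at hle
      rcases lt_or_eq_of_le hle with hlt | heq
      · have := h.1 k k' hlt; omega
      · exact hge (by rw [heq]; exact hk'.2)
    have hc := card_le_card hsub
    rw [Fin.card_Iio] at hc
    unfold qcut at hk
    omega

/-- the blocks STRADDLING cut `g` (at most one). -/
def strad (p : ℕ) (s : Fin N → ℕ) (g : ℕ) : Finset (Fin N) := univ.filter fun k : Fin N => s k < g ∧ g < s k + p

/-- at most one block straddles a cut. -/
theorem card_strad_le_one (h : ((∀ k k', k < k' → s k + p ≤ s k') ∧ (∀ k, s k + p ≤ n))) (g : ℕ) : (strad p s g).card ≤ 1 := by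
  rw [Finset.card_le_one]
  intro k hk k' hk'
  rw [strad, mem_filter] at hk hk'
  by_contra hne
  rcases lt_or_gt_of_ne hne with hlt | hlt
  · have := h.1 k k' hlt; omega
  · have := h.1 k' k hlt; omega

/-- the straddle bit: the value of `v` on the block straddling `g` (`false` if none). -/
def sel (p : ℕ) (s : Fin N → ℕ) (g : ℕ) (v : Fin N → Bool) : Bool := decide (∃ k ∈ strad p s g, v k = true)

/-- the straddle count `Σ_{k ∈ strad g} mcut k g`. -/
def mstr (p : ℕ) (s : Fin N → ℕ) (g : ℕ) : ℕ := ∑ k ∈ strad p s g, mcut (n := n) p s k g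

/-- the straddle part of the prefix weight is the straddle bit times the straddle count. -/
theorem sum_strad_eq (h : ((∀ k k', k < k' → s k + p ≤ s k') ∧ (∀ k, s k + p ≤ n))) (g : ℕ) (v : Fin N → Bool) :
    (∑ k ∈ strad p s g, (if v k = true then mcut (n := n) p s k g else 0))
      = if sel p s g v = true then mstr (n := n) p s g else 0 := by
  rcases (strad p s g).eq_empty_or_nonempty with he | ⟨k₀, hk₀⟩
  · simp [he, sel]
  · have hS : strad p s g = {k₀} :=
      Finset.eq_singleton_iff_unique_mem.mpr ⟨hk₀, fun k hk => Finset.card_le_one.mp (card_strad_le_one h g) k hk k₀ hk₀⟩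
    have hsel : sel p s g v = v k₀ := by
      unfold sel
      rw [hS]
      cases hv : v k₀ <;> simp [hv]
    rw [hsel, mstr, hS, Finset.sum_singleton, Finset.sum_singleton]

/-- **the walk exponent on a block piece**: off-block constant + `p ×` the standard walk exponent of `v` at block position `qcut g`
+ the straddle correction. -/
theorem walkExp_bset (h : ((∀ k k', k < k' → s k + p ≤ s k') ∧ (∀ k, s k + p ≤ n))) (u : Fin n → Bool) (v : Fin N → Bool) (g : ℕ) :
    walkExp (bset p s u v) g
      = offW p s u + offP p s u g + p * walkExp v (qcut p s g) + (if sel p s g v = true then mstr (n := n) p s g else 0) := by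
  unfold walkExp
  rw [wt_bset h, wtPrefix_bset h]
  -- split the block sum by position relative to the cut
  have hsplit : ∀ k : Fin N, (if v k = true then mcut (n := n) p s k g else 0)
      = (if s k + p ≤ g then (if v k = true then p else 0) else 0)
        + (if k ∈ strad p s g then (if v k = true then mcut (n := n) p s k g else 0) else 0) := by
    intro k
    by_cases hb : s k + p ≤ g
    · have hns : k ∉ strad p s g := by
        rw [strad, mem_filter]
        exact fun hh => by omega
      rw [if_pos hb, if_neg hns, mcut_of_before h hb]; simp
    · rw [if_neg hb]
      by_cases hst : k ∈ strad p s g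
      · rw [if_pos hst]; simp
      · rw [if_neg hst]
        have hga : g ≤ s k := by
          by_contra hlt
          exact hst (by rw [strad, mem_filter]; exact ⟨mem_univ _, by omega, by omega⟩)
        rw [mcut_of_after hga]; simp
  rw [Finset.sum_congr rfl fun k _ => hsplit k, Finset.sum_add_distrib]
  -- the straddle part
  have hstr : (∑ k : Fin N, (if k ∈ strad p s g then (if v k = true then mcut (n := n) p s k g else 0) else 0))
      = if sel p s g v = true then mstr (n := n) p s g else 0 := by
    rw [Finset.sum_ite_mem, Finset.univ_inter]
    exact sum_strad_eq h g v
  -- the before part is `p * wtPrefix v (qcut g)`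
  have hbefore : (∑ k : Fin N, (if s k + p ≤ g then (if v k = true then p else 0) else 0))
      = p * wtPrefix v (qcut p s g) := by
    unfold wtPrefix
    rw [Finset.card_filter, Finset.mul_sum]
    refine Finset.sum_congr rfl fun k _ => ?_
    by_cases hb : s k + p ≤ g
    · have hk : k.val < qcut p s g := (before_iff h g k).mp hb
      cases v k <;> simp [hb, hk]
    · have hk : ¬ k.val < qcut p s g := fun hh => hb ((before_iff h g k).mpr hh)
      cases v k <;> simp [hb, hk]
  have hwt : p * wt v = ∑ k : Fin N, (if v k = true then p else 0) := by
    unfold wt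
    rw [Finset.card_filter, Finset.mul_sum]
    refine Finset.sum_congr rfl fun k _ => ?_
    cases v k <;> simp
  rw [hstr, hbefore, Nat.mul_add, hwt]
  ring


end BlockPiece

end Summit.QuantumAdvantage.AdviceFreeQNC0.JLinPeel.BlockDial
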